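import Literature.Geometry.Riemannian.MeanConvexFermiHessian
import Literature.Geometry.Riemannian.MeanConvexGraphHessian

/-!
# The tangent-frame sum of a biradial profile function `Φ(‖P z‖, ⟨e, z⟩)` in the flat model

Topic `Geometry/Riemannian` (fact seat
`provefact-Literature.Geometry.Riemannian.LawsonMichelsohn1984_surrounding`).  Everything here
is **proved**; no definitions.

In the flat model of the junction of Lawson–Michelsohn's surrounding construction (§3) the new
hypersurface near the attaching sphere is a level set `{Φ(r, t) = 0}` read through the two
functions `r = ‖P z‖` (distance to the core, `P` the orthogonal projection onto the `k`-plane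
`K` of normal directions) and `t = ⟨e, z⟩` (height over the mean-convex `Σ = {t = 0}`, `e ⟂ K` a
unit vector).  This file computes, for an **arbitrary** `C²` planar profile `Φ`, the tangent-frame
sum of the Hessian of `G(z) = Φ(‖P z‖, ⟨e, z⟩)` at a point `w` with `P w ≠ 0` and
`∇Φ(r, t) ≠ 0`:

* `frameSum_biradial` —
  `∑ᵢ D²G(w)(vᵢ, vᵢ) = (Φ_rr Φ_t² - (Φ_rt + Φ_tr) Φ_r Φ_t + Φ_tt Φ_r²)/(Φ_r² + Φ_t²) + (k - 1) Φ_r / r`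
  for every orthonormal frame `v` of `ker dG(w)` (`dim E = m + 1`, frames of size `m`): this is
  `‖∇Φ‖` times the mean curvature `κ + (k - 1) sin∠ / r` of the `O(k) × O(n-k-1)`-symmetric
  hypersurface generated by the planar curve `{Φ = 0}` (`κ` its curvature, `∠` the angle of its
  normal with the `t`-axis); the graph zones `Φ = t - τ(r)` (`MeanConvexGraphHessian.frameSum_graphFun`:
  `-τ''/(1 + τ'²) - (k - 1)τ'/r`) and the chimney `Φ = r² - ρ(t)²`
  (`frameSum_chimneyFun`: `2(k - 1) - 2ρρ''/(1 + ρ'²)` on `r = ρ(t)`) are the two special cases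
  used before; the general form is what the patched planar profile of the junction needs.

The proof is the frame-sum identity `∑ᵢ D²G(vᵢ, vᵢ) = tr D²G - D²G(∇G, ∇G)/‖∇G‖²`
(`MeanConvexFrameSum.sum_iteratedFDeriv_two_ker_eq`) with the Hessian of
`MeanConvexFermiHessian.fderiv_fderiv_fermiFun_apply` for the linear Fermi data `Y = P`,
`t = ⟨e, ·⟩` (`D²Y = 0`, `D²t = 0`): `tr D²G = Φ_rr + Φ_tt + (k - 1)Φ_r/r` (double Parseval,
`∑ⱼ ‖P bⱼ‖² = k`) and `D²G(∇G, ∇G) = Φ_rr Φ_r² + (Φ_rt + Φ_tr) Φ_r Φ_t + Φ_tt Φ_t²`,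
`‖∇G‖² = Φ_r² + Φ_t²` (`∇G = Φ_r ŷ + Φ_t e`, `ŷ ⟂ e`).

## References

* H. B. Lawson, Jr., M.-L. Michelsohn, *Embedding and surrounding with positive mean curvature*,
  Invent. Math. 77 (1984), §3. [LawsonMichelsohn1984]
-/

noncomputable section

open Set Function Filter Module
open scoped Topology RealInnerProductSpace

namespace Literature.Geometry.Riemannian

variable {E : Type*} [NormedAddCommGroup E] [InnerProductSpace ℝ E] [FiniteDimensional ℝ E]

section Biradial

variable (K : Submodule ℝ E) (e : E) (Φ : ℝ × ℝ → ℝ) {m : ℕ}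

/-- A linear functional on `ℝ × ℝ` evaluated through its values on `(1, 0)` and `(0, 1)`.
[folklore] -/
theorem clm_prod_apply_eq (L : ℝ × ℝ →L[ℝ] ℝ) (a b : ℝ) :
    L (a, b) = a * L (1, 0) + b * L (0, 1) := by
  have : ((a, b) : ℝ × ℝ) = a • ((1 : ℝ), (0 : ℝ)) + b • ((0 : ℝ), (1 : ℝ)) := by
    ext <;> simp
  rw [this, map_add, map_smul, map_smul, smul_eq_mul, smul_eq_mul]

/-- A bilinear functional on `ℝ × ℝ` on the diagonal, through its four matrix entries. [folklore] -/
theorem clm_prod_apply_apply_eq (H : ℝ × ℝ →L[ℝ] ℝ × ℝ →L[ℝ] ℝ) (a b : ℝ) :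
    H (a, b) (a, b) = a ^ 2 * H (1, 0) (1, 0) + a * b * (H (1, 0) (0, 1) + H (0, 1) (1, 0)) +
      b ^ 2 * H (0, 1) (0, 1) := by
  have h1 : H (a, b) = a • H (1, 0) + b • H (0, 1) := by
    have : ((a, b) : ℝ × ℝ) = a • ((1 : ℝ), (0 : ℝ)) + b • ((0 : ℝ), (1 : ℝ)) := by
      ext <;> simp
    rw [this, map_add, map_smul, map_smul]
  rw [h1]
  show a * H (1, 0) (a, b) + b * H (0, 1) (a, b) = _
  rw [clm_prod_apply_eq (H (1, 0)), clm_prod_apply_eq (H (0, 1))]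
  ring

/-- **The differential of `G(z) = Φ(‖P z‖, ⟨e, z⟩)`** at a point with `y = P w ≠ 0`, `r = ‖y‖`,
`ŷ = r⁻¹ y`: `dG(w) u = Φ_r ⟨ŷ, u⟩ + Φ_t ⟨e, u⟩`. [folklore] -/
theorem fderiv_biradial_apply {w : E} (hw : K.starProjection w ≠ 0)
    (hΦ : DifferentiableAt ℝ Φ (‖K.starProjection w‖, ⟪e, w⟫)) (u : E) :
    fderiv ℝ (fun z : E => Φ (‖K.starProjection z‖, ⟪e, z⟫)) w u =
      fderiv ℝ Φ (‖K.starProjection w‖, ⟪e, w⟫) (1, 0) *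
          ⟪‖K.starProjection w‖⁻¹ • K.starProjection w, u⟫ +
        fderiv ℝ Φ (‖K.starProjection w‖, ⟪e, w⟫) (0, 1) * ⟪e, u⟫ := by
  set P := K.starProjection with hP
  have hnd : DifferentiableAt ℝ (fun z : E => ‖P z‖) w :=
    (Literature.Analysis.Potential.HyperbolicBall.hasFDerivAt_norm_of_ne_zero hw).differentiableAt.comp
      w P.differentiableAt
  have htd : DifferentiableAt ℝ (fun z : E => ⟪e, z⟫) w := (innerSL ℝ e).differentiableAt
  have hψd : DifferentiableAt ℝ (fun z : E => (‖P z‖, ⟪e, z⟫)) w := hnd.prodMk htd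
  have hchain : fderiv ℝ (fun z : E => Φ (‖P z‖, ⟪e, z⟫)) w =
      (fderiv ℝ Φ (‖P w‖, ⟪e, w⟫)).comp (fderiv ℝ (fun z : E => (‖P z‖, ⟪e, z⟫)) w) :=
    fderiv_comp w hΦ hψd
  rw [hchain, ContinuousLinearMap.comp_apply, hnd.fderiv_prodMk htd]
  simp only [ContinuousLinearMap.prod_apply]
  have h1 : fderiv ℝ (fun z : E => ‖P z‖) w u = ⟪‖P w‖⁻¹ • P w, P u⟫ := by
    rw [show (fun z : E => ‖P z‖) = fun z => ‖(fun z : E => P z) z‖ from rfl,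
      fderiv_norm_comp_apply P.differentiableAt hw u, ContinuousLinearMap.fderiv]
  have h2 : fderiv ℝ (fun z : E => ⟪e, z⟫) w u = ⟪e, u⟫ := by
    rw [show (fun z : E => ⟪e, z⟫) = innerSL ℝ e from rfl, ContinuousLinearMap.fderiv]; rfl
  have hmem : ‖P w‖⁻¹ • P w ∈ K := K.smul_mem _ (K.starProjection_apply_mem w)
  rw [h1, h2, inner_starProjection_of_mem K hmem, clm_prod_apply_eq]
  ring

/-- **The Hessian of `G(z) = Φ(‖P z‖, ⟨e, z⟩)`** at a point with `y = P w ≠ 0`, `r = ‖y‖`,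
`ŷ = r⁻¹ y` (`Φ` of class `C²` there): with `a(u) = ⟨ŷ, u⟩`, `b(u) = ⟨e, u⟩`,
`D²G(w)(u, u') = D²Φ((a u, b u), (a u', b u')) + Φ_r (⟨P u, u'⟩ - a(u) a(u'))/r`. [folklore] -/
theorem fderiv_fderiv_biradial_apply {w : E} (hw : K.starProjection w ≠ 0)
    (hΦ : ContDiffAt ℝ 2 Φ (‖K.starProjection w‖, ⟪e, w⟫)) (u u' : E) :
    fderiv ℝ (fderiv ℝ (fun z : E => Φ (‖K.starProjection z‖, ⟪e, z⟫))) w u u' =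
      fderiv ℝ (fderiv ℝ Φ) (‖K.starProjection w‖, ⟪e, w⟫)
          (⟪‖K.starProjection w‖⁻¹ • K.starProjection w, u⟫, ⟪e, u⟫)
          (⟪‖K.starProjection w‖⁻¹ • K.starProjection w, u'⟫, ⟪e, u'⟫) +
        fderiv ℝ Φ (‖K.starProjection w‖, ⟪e, w⟫) (1, 0) *
          ((⟪K.starProjection u, u'⟫ -
              ⟪‖K.starProjection w‖⁻¹ • K.starProjection w, u⟫ *
                ⟪‖K.starProjection w‖⁻¹ • K.starProjection w, u'⟫) / ‖K.starProjection w‖) := by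
  set P := K.starProjection with hP
  have hY : ContDiffAt ℝ 2 (fun z : E => P z) w := P.contDiff.contDiffAt
  have ht : ContDiffAt ℝ 2 (fun z : E => ⟪e, z⟫) w := (innerSL ℝ e).contDiff.contDiffAt
  have h := fderiv_fderiv_fermiFun_apply (Φ := Φ) (Y := fun z : E => P z) (t := fun z : E => ⟪e, z⟫)
    hY ht hw hΦ u u'
  have hDY : fderiv ℝ (fun z : E => P z) w = P := P.fderiv
  have hD2Y : fderiv ℝ (fderiv ℝ (fun z : E => P z)) w = 0 := by
    have : fderiv ℝ (fun z : E => P z) = fun _ => P := funext fun z => P.fderiv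
    rw [this]; exact fderiv_const_apply _
  have hDt : fderiv ℝ (fun z : E => ⟪e, z⟫) w = innerSL ℝ e := (innerSL ℝ e).fderiv
  have hD2t : fderiv ℝ (fderiv ℝ (fun z : E => ⟪e, z⟫)) w = 0 := by
    have : fderiv ℝ (fun z : E => ⟪e, z⟫) = fun _ => innerSL ℝ e :=
      funext fun z => (innerSL ℝ e).fderiv
    rw [this]; exact fderiv_const_apply _
  have hmem : ‖P w‖⁻¹ • P w ∈ K := K.smul_mem _ (K.starProjection_apply_mem w)
  have hD2Y' : fderiv ℝ (fderiv ℝ fun z : E => P z) w u u' = 0 := by rw [hD2Y]; rfl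
  have hD2t' : fderiv ℝ (fderiv ℝ fun z : E => ⟪e, z⟫) w u u' = 0 := by rw [hD2t]; rfl
  have hPP : ⟪P u, P u'⟫ = ⟪P u, u'⟫ := inner_starProjection_of_mem K (K.starProjection_apply_mem u) u'
  show fderiv ℝ (fun z => fderiv ℝ (fun z : E => Φ (‖P z‖, ⟪e, z⟫)) z) w u u' = _
  rw [h, hDY, hD2Y', hD2t', hDt, inner_zero_right, add_zero, mul_zero, add_zero, innerSL_apply_apply,
    innerSL_apply_apply, inner_starProjection_of_mem K hmem u, inner_starProjection_of_mem K hmem u',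
    hPP]

/-- **The tangent-frame sum of a biradial profile function in the flat model.**  Let `e` be a
unit vector orthogonal to `K` (`dim E = m + 1`, `k = dim K`), `w` a point with `y = P w ≠ 0`,
`r = ‖y‖`, `t = ⟨e, w⟩`, and `Φ` of class `C²` at `(r, t)` with `(Φ_r, Φ_t) ≠ (0, 0)` there.
Then for every orthonormal `m`-frame `v` of `ker dG(w)`, `G(z) = Φ(‖P z‖, ⟨e, z⟩)`:
`∑ᵢ D²G(w)(vᵢ, vᵢ) = (Φ_rr Φ_t² - (Φ_rt + Φ_tr) Φ_r Φ_t + Φ_tt Φ_r²)/(Φ_r² + Φ_t²) + (k - 1) Φ_r/r`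
— `‖∇Φ‖` times the flat mean curvature of the hypersurface of revolution generated by the planar
curve `{Φ = 0}`. [cite: LawsonMichelsohn1984, §3] -/
theorem frameSum_biradial (hE : finrank ℝ E = m + 1) (he : ‖e‖ = 1) (heK : e ∈ Kᗮ) {w : E}
    (hw : K.starProjection w ≠ 0) (hΦ : ContDiffAt ℝ 2 Φ (‖K.starProjection w‖, ⟪e, w⟫))
    (hgrad : fderiv ℝ Φ (‖K.starProjection w‖, ⟪e, w⟫) (1, 0) ≠ 0 ∨
      fderiv ℝ Φ (‖K.starProjection w‖, ⟪e, w⟫) (0, 1) ≠ 0)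
    {v : Fin m → E} (hv : Orthonormal ℝ v)
    (hvf : ∀ i, fderiv ℝ (fun z : E => Φ (‖K.starProjection z‖, ⟪e, z⟫)) w (v i) = 0) :
    ∑ i, iteratedFDeriv ℝ 2 (fun z : E => Φ (‖K.starProjection z‖, ⟪e, z⟫)) w ![v i, v i] =
      (fderiv ℝ (fderiv ℝ Φ) (‖K.starProjection w‖, ⟪e, w⟫) (1, 0) (1, 0) *
            fderiv ℝ Φ (‖K.starProjection w‖, ⟪e, w⟫) (0, 1) ^ 2 -
          (fderiv ℝ (fderiv ℝ Φ) (‖K.starProjection w‖, ⟪e, w⟫) (1, 0) (0, 1) +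
              fderiv ℝ (fderiv ℝ Φ) (‖K.starProjection w‖, ⟪e, w⟫) (0, 1) (1, 0)) *
            fderiv ℝ Φ (‖K.starProjection w‖, ⟪e, w⟫) (1, 0) *
            fderiv ℝ Φ (‖K.starProjection w‖, ⟪e, w⟫) (0, 1) +
          fderiv ℝ (fderiv ℝ Φ) (‖K.starProjection w‖, ⟪e, w⟫) (0, 1) (0, 1) *
            fderiv ℝ Φ (‖K.starProjection w‖, ⟪e, w⟫) (1, 0) ^ 2) /
          (fderiv ℝ Φ (‖K.starProjection w‖, ⟪e, w⟫) (1, 0) ^ 2 +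
            fderiv ℝ Φ (‖K.starProjection w‖, ⟪e, w⟫) (0, 1) ^ 2) +
        ((finrank ℝ K : ℝ) - 1) * fderiv ℝ Φ (‖K.starProjection w‖, ⟪e, w⟫) (1, 0) /
          ‖K.starProjection w‖ := by
  set P := K.starProjection with hP
  set y : E := P w with hy
  set r : ℝ := ‖y‖ with hr
  set t : ℝ := ⟪e, w⟫ with ht
  obtain ⟨yh, hyh⟩ : ∃ yh : E, yh = r⁻¹ • y := ⟨_, rfl⟩
  set Φr : ℝ := fderiv ℝ Φ (r, t) (1, 0) with hΦr
  set Φt : ℝ := fderiv ℝ Φ (r, t) (0, 1) with hΦt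
  set H := fderiv ℝ (fderiv ℝ Φ) (r, t) with hH
  have hrpos : 0 < r := norm_pos_iff.2 hw
  have hyK : y ∈ K := K.starProjection_apply_mem w
  have hyhK : yh ∈ K := by rw [hyh]; exact K.smul_mem _ hyK
  have hyh1 : ‖yh‖ = 1 := by
    rw [hyh, norm_smul, norm_inv, Real.norm_eq_abs, abs_of_pos hrpos, inv_mul_cancel₀ hrpos.ne']
  have heyh : ⟪yh, e⟫ = 0 := (Submodule.mem_orthogonal K e).1 heK yh hyhK
  have heyh' : ⟪e, yh⟫ = 0 := by rw [real_inner_comm]; exact heyh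
  set G : E → ℝ := fun z => Φ (‖P z‖, ⟪e, z⟫) with hG
  have hΦd : DifferentiableAt ℝ Φ (r, t) := hΦ.differentiableAt (by simp)
  -- the differential and its Riesz vector `g = Φr yh + Φt e`
  have hdG : ∀ u, fderiv ℝ G w u = Φr * ⟪yh, u⟫ + Φt * ⟪e, u⟫ := fun u => by
    rw [hyh]; exact fderiv_biradial_apply K e Φ hw hΦd u
  set g : E := Φr • yh + Φt • e with hg
  have hgdual : (InnerProductSpace.toDual ℝ E).symm (fderiv ℝ G w) = g := by
    apply (InnerProductSpace.toDual ℝ E).injective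
    rw [LinearIsometryEquiv.apply_symm_apply]
    ext u
    rw [InnerProductSpace.toDual_apply_apply, hdG u, hg, inner_add_left, real_inner_smul_left,
      real_inner_smul_left]
  have hng : ‖g‖ ^ 2 = Φr ^ 2 + Φt ^ 2 := by
    rw [hg, @norm_add_sq_real, norm_smul, norm_smul, hyh1, he, mul_one, mul_one, Real.norm_eq_abs,
      Real.norm_eq_abs, sq_abs, sq_abs, real_inner_smul_left, real_inner_smul_right, heyh]
    ring
  have hsq : Φr ^ 2 + Φt ^ 2 ≠ 0 := by
    intro h0
    obtain ⟨h1, h2⟩ := (add_eq_zero_iff_of_nonneg (sq_nonneg Φr) (sq_nonneg Φt)).1 h0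
    rcases hgrad with h | h
    · exact h ((pow_eq_zero_iff two_ne_zero).1 h1)
    · exact h ((pow_eq_zero_iff two_ne_zero).1 h2)
  have hdGne : fderiv ℝ G w ≠ 0 := by
    intro h0
    have hg0 : g = 0 := by rw [← hgdual, h0, map_zero]
    have : ‖g‖ ^ 2 = 0 := by rw [hg0, norm_zero]; ring
    rw [hng] at this
    exact hsq this
  -- the Hessian values
  have hHv : ∀ u u' : E, iteratedFDeriv ℝ 2 G w ![u, u'] =
      H (⟪yh, u⟫, ⟪e, u⟫) (⟪yh, u'⟫, ⟪e, u'⟫) + Φr * ((⟪P u, u'⟫ - ⟪yh, u⟫ * ⟪yh, u'⟫) / r) :=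
    fun u u' => by
    rw [iteratedFDeriv_two_vecCons, hyh]
    exact fderiv_fderiv_biradial_apply K e Φ hw hΦ u u'
  -- the general frame-sum identity
  have key := sum_iteratedFDeriv_two_ker_eq hE hdGne (stdOrthonormalBasis ℝ E) hv hvf
  rw [key, hgdual]
  set b := stdOrthonormalBasis ℝ E with hb
  -- the trace: `Φ_rr + Φ_tt + (k - 1) Φ_r / r`
  have htr : ∑ j, iteratedFDeriv ℝ 2 G w ![b j, b j] =
      H (1, 0) (1, 0) + H (0, 1) (0, 1) + Φr * (((finrank ℝ K : ℝ) - 1) / r) := by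
    have hHb : ∀ j, iteratedFDeriv ℝ 2 G w ![b j, b j] =
        ⟪yh, b j⟫ ^ 2 * H (1, 0) (1, 0) + ⟪yh, b j⟫ * ⟪e, b j⟫ * (H (1, 0) (0, 1) + H (0, 1) (1, 0)) +
          ⟪e, b j⟫ ^ 2 * H (0, 1) (0, 1) + Φr * ((⟪P (b j), b j⟫ - ⟪yh, b j⟫ * ⟪yh, b j⟫) / r) :=
      fun j => by rw [hHv, clm_prod_apply_apply_eq]
    rw [Finset.sum_congr rfl fun j _ => hHb j]
    rw [Finset.sum_add_distrib, Finset.sum_add_distrib, Finset.sum_add_distrib, ← Finset.sum_mul,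
      ← Finset.sum_mul, ← Finset.sum_mul, ← Finset.mul_sum]
    have h1 : ∑ j, ⟪yh, b j⟫ ^ 2 = 1 := by rw [b.sum_sq_inner_left yh, hyh1, one_pow]
    have h2 : ∑ j, ⟪e, b j⟫ ^ 2 = 1 := by rw [b.sum_sq_inner_left e, he, one_pow]
    have h3 : ∑ j, ⟪yh, b j⟫ * ⟪e, b j⟫ = 0 := by
      have := b.sum_inner_mul_inner yh e
      rw [heyh] at this
      rw [← this]
      exact Finset.sum_congr rfl fun j _ => by rw [real_inner_comm (b j) e]
    have h4 : ∑ j, (⟪P (b j), b j⟫ - ⟪yh, b j⟫ * ⟪yh, b j⟫) / r = ((finrank ℝ K : ℝ) - 1) / r := by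
      rw [← Finset.sum_div, Finset.sum_sub_distrib]
      congr 1
      have hP' : ∑ j, ⟪P (b j), b j⟫ = (finrank ℝ K : ℝ) := by
        rw [← sum_norm_sq_starProjection K b]
        exact Finset.sum_congr rfl fun j _ => inner_starProjection_self_eq_norm_sq K (b j)
      have hy' : ∑ j, ⟪yh, b j⟫ * ⟪yh, b j⟫ = 1 := by
        rw [← h1]; exact Finset.sum_congr rfl fun j _ => (sq _).symm
      rw [hP', hy']
    rw [h1, h2, h3, h4]
    ring
  -- the normal value: `Φ_rr Φ_r² + (Φ_rt + Φ_tr) Φ_r Φ_t + Φ_tt Φ_t²`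
  have hyg : ⟪yh, g⟫ = Φr := by
    rw [hg, inner_add_right, real_inner_smul_right, real_inner_smul_right, real_inner_self_eq_norm_sq,
      hyh1, heyh]; ring
  have heg : ⟪e, g⟫ = Φt := by
    rw [hg, inner_add_right, real_inner_smul_right, real_inner_smul_right, heyh',
      real_inner_self_eq_norm_sq, he]; ring
  have hPg : P g = Φr • yh := by
    rw [hg, map_add, map_smul, map_smul, (Submodule.starProjection_eq_self_iff).2 hyhK,
      (Submodule.starProjection_apply_eq_zero_iff (K := K)).2 heK, smul_zero, add_zero]
  have hgg : iteratedFDeriv ℝ 2 G w ![g, g] =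
      Φr ^ 2 * H (1, 0) (1, 0) + Φr * Φt * (H (1, 0) (0, 1) + H (0, 1) (1, 0)) +
        Φt ^ 2 * H (0, 1) (0, 1) := by
    rw [hHv, hyg, heg, hPg, real_inner_smul_left, hyg, clm_prod_apply_apply_eq]
    have : (Φr * Φr - Φr * Φr) / r = 0 := by rw [sub_self, zero_div]
    rw [this, mul_zero, add_zero]
  have hden : Φr ^ 2 + Φt ^ 2 ≠ 0 := hsq
  set A : ℝ := H (1, 0) (1, 0) with hA
  set B : ℝ := H (1, 0) (0, 1) with hB
  set B' : ℝ := H (0, 1) (1, 0) with hB'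
  set C : ℝ := H (0, 1) (0, 1) with hC
  set kk : ℝ := (finrank ℝ K : ℝ) with hkk
  rw [htr, hgg, hng]
  have e1 : A + C - (Φr ^ 2 * A + Φr * Φt * (B + B') + Φt ^ 2 * C) / (Φr ^ 2 + Φt ^ 2) =
      (A * Φt ^ 2 - (B + B') * Φr * Φt + C * Φr ^ 2) / (Φr ^ 2 + Φt ^ 2) := by
    rw [eq_div_iff hden, sub_mul, div_mul_cancel₀ _ hden]
    ring
  have e2 : Φr * ((kk - 1) / r) = (kk - 1) * Φr / r := by ring
  linear_combination e1 + e2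

end Biradial

end Literature.Geometry.Riemannian

end
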